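import Summits.KontsevichZagierPeriods.KontsevichZagierPeriods.Theorems.RootDecompWalshStrataBallMoves

/-!
# Ball-cube descent 4/7: the boundary curves re-parametrised by `x` and the `√(7 − 4x²)`-cancellation

Gen 5 of the decomposition node `WalshStrata` (route `RootDecompWalshStrata`, support item
`QuadricBakerDescent` stmt-KontsevichZagierPeriods-27597, its `d = 3` slice): the first two-variable
`√(quadratic)` weight over CUBE-CUT cells decided inside KZ's rules (1)–(3) over `ℚ` —
`sqrtDescent₂_ball : ∀ γ, SqrtDescent₂ K₇ γ` (part 6) for the ball quadric `P = 7/4 − x² − y² − z²`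
(`D = 7 − 4x² − 4y²`; atoms = the disc `x² + y² < 3/4` and the annulus `3/4 < x² + y² < 7/4` cut by
the faces `x = 1`, `y = 1`, plus null/empty/zero-weight atoms), and the corollary
`ballCube_bakerDescent` (part 7): `(d, P, q) = (3, 7/4 − Σxᵢ², q)` is an instance of
`QuadricBakerDescent` for every `q ∈ ℚ`.  Mechanism: the fibrewise vertex chart
`(v, x) ↦ (x, s(x)·v/(1 + v²))`, `s = √(7 − 4x²)`, makes `√D·|det| = (7 − 4x²)(1 − v²)²/(1 + v²)³`
RATIONAL; Newton–Leibniz in `x` over an arbitrary semialgebraic base (the landed band identity); the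
`√(7 − 4x²)`-CANCELLATION on the algebraic edges `x² = β(v)` (circle) and `x² = α(v)` (face `y = 1`)
under the charts `v₁ = 2p/(s + 2)`, `v₂ = 2/(s + 2p)` (`p = √(3/4 − x²)`) reduces both boundary terms to
`E(x²)·√(3/4 − x²)`, `E ∈ ℚ(X)`, hence to rational integrands by the Euler chart of `x² + y² = 3/4`.
This part: `p(x) = √(3/4 − x²)`, the semialgebraic set `T = {0 < x, x² < 3/4}`, the inverse edge
charts `v₁(x) = 2p/(s + 2)` (circle: `β(v₁ x) = x²`) and `v₂(x) = 2/(s + 2p)` (face: `α(v₂ x) = x²`)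
with their derivatives, and the CANCELLATION identities `g(v₁)·|v₁'| = 8x/(p(7 − 4x²)²)`,
`g(v₂)·|v₂'| = 8xp/(7 − 4x²)²` — the factor `s = √(7 − 4x²)` of the weight `c(7x − 4x³/3)g(v)`
disappears, leaving ONE square root `p`.  Imports: part 3; 0 sorry. [this node, gen 5]
-/

noncomputable section

open Literature.NumberTheory.Transcendental
open MeasureTheory Set
open MvPolynomial (aeval X C)
open Literature.ModelTheory.ExponentialFields (IsSemialgebraic isSemialgebraic_univ
  isSemialgebraic_setOf_eval_pos isSemialgebraic_setOf_eval_lt isSemialgebraic_setOf_eval_le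
  isSemialgebraic_setOf_eval_nonneg isSemialgebraic_setOf_eval_eq_zero continuous_aeval_real
  tarski_seidenberg_real_holds)
open Summit.KontsevichZagierPeriods.RootDecompWalshStrata.WalshSpanProof (isSemialgebraic_cubeSet
  isBounded_cubeSet)
open Summit.KontsevichZagierPeriods.RootDecompWalshStrata.ConeSpecimen (unitIoo isSemialgebraic_unitIoo
  unitIoo_subset_Icc mem_unitIoo)
open Summit.KontsevichZagierPeriods.RootDecompWalshStrata.PointlessOctant (boxTwo isSemialgebraic_boxTwo
  boxTwo_subset_Icc euler_inj)

namespace Summit.KontsevichZagierPeriods.RootDecompWalshStrata.ConicDescent.BallCube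

/-! #### 23.9 The boundary curves re-parametrised by `x`, and the `√(7 − 4x²)`-cancellation -/

/-- `{v | 0 < v 0}` is `ℚ`-semialgebraic (file-local copy). [BCR1998 §2.2] -/
private theorem isSemialgebraic_T_pos : IsSemialgebraic ℚ {v : Fin 1 → ℝ | 0 < v 0} := by
  convert isSemialgebraic_setOf_eval_pos (k := ℚ) (R := ℝ)
    (MvPolynomial.X (0 : Fin 1) : MvPolynomial (Fin 1) ℚ) using 1
  ext v
  simp

/-- `p(x) = √(3/4 − x²)`. -/
def chP (x : ℝ) : ℝ := √(3 / 4 - x ^ 2)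

/-- Lemma `chP_pos` of the ball-cube descent (gen 5; see the section docstring). [this node] -/
theorem chP_pos {x : ℝ} (hx : x ^ 2 < 3 / 4) : 0 < chP x := Real.sqrt_pos.2 (by linarith)

/-- Lemma `chP_sq` of the ball-cube descent (gen 5; see the section docstring). [this node] -/
theorem chP_sq {x : ℝ} (hx : x ^ 2 ≤ 3 / 4) : chP x ^ 2 = 3 / 4 - x ^ 2 := Real.sq_sqrt (by linarith)

/-- `p'(x) = −x/p(x)` for `x² < 3/4`. [calculus] -/
theorem hasDerivAt_chP {x : ℝ} (hx : x ^ 2 < 3 / 4) : HasDerivAt chP (-x / chP x) x := by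
  have h1 : HasDerivAt (fun x : ℝ => 3 / 4 - x ^ 2) (-(↑(2 : ℕ) * x ^ (2 - 1))) x :=
    (hasDerivAt_pow 2 x).const_sub (3 / 4)
  have hne : 3 / 4 - x ^ 2 ≠ 0 := by linarith
  refine (h1.sqrt hne).congr_deriv ?_
  rw [chP]
  have hs : 0 < √(3 / 4 - x ^ 2) := Real.sqrt_pos.2 (by linarith)
  field_simp
  push_cast
  ring

/-- The chart domain `T = {x | 0 < x, x² < 3/4}` of both boundary curves. -/
def Tq : Set (Fin 1 → ℝ) := {x | 0 < x 0 ∧ x 0 ^ 2 < 3 / 4}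

/-- Lemma `isSemialgebraic_Tq` of the ball-cube descent (gen 5; see the section docstring). [this node] -/
theorem isSemialgebraic_Tq : IsSemialgebraic ℚ Tq := by
  have h := isSemialgebraic_T_pos.inter (isSemialgebraic_T_sq_lt (3 / 4))
  convert h using 1
  ext x
  simp only [Tq, mem_inter_iff, mem_setOf_eq]
  norm_num

/-- Lemma `isSemialgebraicFunOn_chS_Tq` of the ball-cube descent (gen 5; see the section docstring). [this node] -/
theorem isSemialgebraicFunOn_chS_Tq : IsSemialgebraicFunOn ℚ Tq fun x => chS (x 0) :=
  (IsSemialgebraicFunOn.sqrt_holds (isSemialgebraicFunOn_aeval isSemialgebraic_Tq (7 - 4 * X 0 ^ 2))).congr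
    fun x _ => by simp only [map_sub, map_mul, map_pow, MvPolynomial.aeval_X, map_ofNat, chS]

/-- Lemma `isSemialgebraicFunOn_chP_Tq` of the ball-cube descent (gen 5; see the section docstring). [this node] -/
theorem isSemialgebraicFunOn_chP_Tq : IsSemialgebraicFunOn ℚ Tq fun x => chP (x 0) :=
  (IsSemialgebraicFunOn.sqrt_holds (isSemialgebraicFunOn_aeval isSemialgebraic_Tq
    (MvPolynomial.C (3 / 4) - X 0 ^ 2))).congr fun x _ => by
      simp only [map_sub, map_pow, MvPolynomial.aeval_X, MvPolynomial.aeval_C, eq_ratCast, chP]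
      push_cast; ring_nf

/-- The `x`-chart `v₁(x) = 2p(x)/(s(x) + 2)` of the curve `x² = β(v)` (image of the circle
`x² + y² = 3/4`): the point of the circle above `x` is `y = p(x) = s(x)v/(1 + v²)`. -/
def v₁ (x : ℝ) : ℝ := 2 * chP x / (chS x + 2)

/-- `v₁'(x)` (quotient rule, unsimplified; `= −4x/(p·s·(s + 2))`). -/
def v₁d (x : ℝ) : ℝ :=
  (2 * (-x / chP x) * (chS x + 2) - 2 * chP x * (-(4 * x) / chS x)) / (chS x + 2) ^ 2

/-- The `x`-chart `v₂(x) = 2/(s(x) + 2p(x))` of the curve `x² = α(v)` (image of the face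
`y = 1`): `1 = s(x)v/(1 + v²)`. -/
def v₂ (x : ℝ) : ℝ := 2 / (chS x + 2 * chP x)

/-- `v₂'(x)` (quotient rule, unsimplified; `= 4x/(p·s·(s + 2p))`). -/
def v₂d (x : ℝ) : ℝ :=
  (0 * (chS x + 2 * chP x) - 2 * (-(4 * x) / chS x + 2 * (-x / chP x))) / (chS x + 2 * chP x) ^ 2

section facts
variable {x : ℝ} (hx : x ^ 2 < 3 / 4)
include hx

/-- Lemma `hx74_of` of the ball-cube descent (gen 5; see the section docstring). [this node] -/
theorem hx74_of : x ^ 2 < 7 / 4 := by linarith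

/-- Lemma `hasDerivAt_v₁` of the ball-cube descent (gen 5; see the section docstring). [this node] -/
theorem hasDerivAt_v₁ : HasDerivAt v₁ (v₁d x) x := by
  have hne : chS x + 2 ≠ 0 := by linarith [two_lt_chS hx]
  exact ((hasDerivAt_chP hx).const_mul 2).div ((hasDerivAt_chS (by linarith)).add_const 2) hne

/-- Lemma `hasDerivAt_v₂` of the ball-cube descent (gen 5; see the section docstring). [this node] -/
theorem hasDerivAt_v₂ : HasDerivAt v₂ (v₂d x) x := by
  have hne : chS x + 2 * chP x ≠ 0 := by linarith [two_lt_chS hx, chP_pos hx]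
  exact (hasDerivAt_const x (2 : ℝ)).div ((hasDerivAt_chS (by linarith)).add
    ((hasDerivAt_chP hx).const_mul 2)) hne

/-- `(2p)² = (s + 2)² − 4(s + 2)` (i.e. `s² − 4 = 4p²`). -/
theorem two_chP_sq : (2 * chP x) ^ 2 = (chS x + 2) ^ 2 - 4 * (chS x + 2) := by
  linear_combination 4 * chP_sq hx.le - chS_sq (hx74_of hx).le

/-- Lemma `one_sub_v₁_sq` of the ball-cube descent (gen 5; see the section docstring). [this node] -/
theorem one_sub_v₁_sq : 1 - v₁ x ^ 2 = 4 / (chS x + 2) := by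
  have hne : chS x + 2 ≠ 0 := by linarith [two_lt_chS hx]
  rw [v₁, div_pow, two_chP_sq hx]
  field_simp
  ring

/-- Lemma `one_add_v₁_sq` of the ball-cube descent (gen 5; see the section docstring). [this node] -/
theorem one_add_v₁_sq : 1 + v₁ x ^ 2 = 2 * chS x / (chS x + 2) := by
  have hne : chS x + 2 ≠ 0 := by linarith [two_lt_chS hx]
  rw [v₁, div_pow, two_chP_sq hx]
  field_simp
  ring

/-- Lemma `v₁_sq` of the ball-cube descent (gen 5; see the section docstring). [this node] -/
theorem v₁_sq : v₁ x ^ 2 = (chS x - 2) / (chS x + 2) := by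
  have hne : chS x + 2 ≠ 0 := by linarith [two_lt_chS hx]
  have h := one_sub_v₁_sq hx
  field_simp at h ⊢
  linarith

/-- Lemma `chG_v₁` of the ball-cube descent (gen 5; see the section docstring). [this node] -/
theorem chG_v₁ : chG (v₁ x) = 2 * (chS x + 2) / chS x ^ 3 := by
  have hs := two_lt_chS hx
  have hne : chS x + 2 ≠ 0 := by linarith
  have hne' : chS x ≠ 0 := by linarith
  rw [chG, one_sub_v₁_sq hx, one_add_v₁_sq hx]
  field_simp
  ring

/-- `β(v₁(x)) = x²`: `v₁` parametrises the curve `x² = β(v)`. -/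
theorem chβ_v₁ : chβ (v₁ x) = x ^ 2 := by
  have hs := two_lt_chS hx
  have hne : chS x + 2 ≠ 0 := by linarith
  have hs2 := chS_sq (hx74_of hx).le
  calc chβ (v₁ x) = (3 * (2 * chS x / (chS x + 2)) ^ 2 - 28 * ((chS x - 2) / (chS x + 2))) /
        (4 * (4 / (chS x + 2)) ^ 2) := by rw [chβ, one_add_v₁_sq hx, one_sub_v₁_sq hx, v₁_sq hx]
    _ = (112 - 16 * chS x ^ 2) / 64 := by field_simp; ring
    _ = x ^ 2 := by rw [hs2]; ring

/-- Lemma `v₁d_eq` of the ball-cube descent (gen 5; see the section docstring). [this node] -/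
theorem v₁d_eq : v₁d x = -(4 * x) / (chP x * chS x * (chS x + 2)) := by
  have hs := two_lt_chS hx
  have hp := chP_pos hx
  have hne : chS x + 2 ≠ 0 := by linarith
  have hne' : chS x ≠ 0 := by linarith
  have hs2 := chS_sq (hx74_of hx).le
  have hp2 := chP_sq hx.le
  rw [v₁d, div_eq_div_iff (pow_ne_zero 2 hne) (by positivity)]
  have e : (2 * (-x / chP x) * (chS x + 2) - 2 * chP x * (-(4 * x) / chS x)) *
      (chP x * chS x * (chS x + 2)) =
      (-(2 * x) * chS x * (chS x + 2) + 8 * x * chP x ^ 2) * (chS x + 2) := by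
    field_simp
    ring
  rw [e]
  linear_combination (-(2 * (chS x + 2) * x)) * hs2 + (8 * (chS x + 2) * x) * hp2

/-- **The cancellation on the circle:** `g(v₁(x))·|v₁'(x)| = 8x/(p(x)(7 − 4x²)²)` — the factor
`s = √(7 − 4x²)` only enters through `s⁴`. -/
theorem chG_v₁_mul_abs (hx0 : 0 < x) : chG (v₁ x) * |v₁d x| = 8 * x / (chP x * (7 - 4 * x ^ 2) ^ 2) := by
  have hs := two_lt_chS hx
  have hp := chP_pos hx
  have hne' : chS x ≠ 0 := by linarith
  have hneg : v₁d x < 0 := by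
    rw [v₁d_eq hx]
    exact div_neg_of_neg_of_pos (by linarith) (by positivity)
  rw [abs_of_neg hneg, v₁d_eq hx, chG_v₁ hx, ← chS_sq (hx74_of hx).le]
  field_simp
  ring

/-- `(s + 2p)² − 4 = 4p(s + 2p)` and `(s + 2p)² + 4 = 2s(s + 2p)` (from `s² − 4 = 4p²`). -/
theorem sq_add_two_chP :
    (chS x + 2 * chP x) ^ 2 - 4 = 4 * chP x * (chS x + 2 * chP x) ∧
      (chS x + 2 * chP x) ^ 2 + 4 = 2 * chS x * (chS x + 2 * chP x) := by
  have hs2 := chS_sq (hx74_of hx).le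
  have hp2 := chP_sq hx.le
  constructor
  · linear_combination hs2 - 4 * hp2
  · linear_combination 4 * hp2 - hs2

/-- Lemma `one_sub_v₂_sq` of the ball-cube descent (gen 5; see the section docstring). [this node] -/
theorem one_sub_v₂_sq : 1 - v₂ x ^ 2 = 4 * chP x / (chS x + 2 * chP x) := by
  have hne : chS x + 2 * chP x ≠ 0 := by linarith [two_lt_chS hx, chP_pos hx]
  have h := (sq_add_two_chP hx).1
  rw [v₂, div_pow, eq_div_iff hne]
  field_simp
  linear_combination h

/-- Lemma `one_add_v₂_sq` of the ball-cube descent (gen 5; see the section docstring). [this node] -/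
theorem one_add_v₂_sq : 1 + v₂ x ^ 2 = 2 * chS x / (chS x + 2 * chP x) := by
  have hne : chS x + 2 * chP x ≠ 0 := by linarith [two_lt_chS hx, chP_pos hx]
  have h := (sq_add_two_chP hx).2
  rw [v₂, div_pow, eq_div_iff hne]
  field_simp
  linear_combination h

/-- Lemma `chG_v₂` of the ball-cube descent (gen 5; see the section docstring). [this node] -/
theorem chG_v₂ : chG (v₂ x) = 2 * chP x ^ 2 * (chS x + 2 * chP x) / chS x ^ 3 := by
  have hs := two_lt_chS hx
  have hp := chP_pos hx
  have hne : chS x + 2 * chP x ≠ 0 := by linarith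
  have hne' : chS x ≠ 0 := by linarith
  rw [chG, one_sub_v₂_sq hx, one_add_v₂_sq hx]
  field_simp
  ring

/-- `α(v₂(x)) = x²`: `v₂` parametrises the curve `x² = α(v)`. -/
theorem chα_v₂ : chα (v₂ x) = x ^ 2 := by
  have hs := two_lt_chS hx
  have hp := chP_pos hx
  have hne : chS x + 2 * chP x ≠ 0 := by linarith
  have hs2 := chS_sq (hx74_of hx).le
  have hv2 : v₂ x ^ 2 = 4 / (chS x + 2 * chP x) ^ 2 := by rw [v₂, div_pow]; norm_num
  calc chα (v₂ x) = (7 * (4 / (chS x + 2 * chP x) ^ 2) - (2 * chS x / (chS x + 2 * chP x)) ^ 2) /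
        (4 * (4 / (chS x + 2 * chP x) ^ 2)) := by rw [chα, one_add_v₂_sq hx, hv2]
    _ = (28 - 4 * chS x ^ 2) / 16 := by field_simp; ring
    _ = x ^ 2 := by rw [hs2]; ring

/-- Lemma `v₂d_eq` of the ball-cube descent (gen 5; see the section docstring). [this node] -/
theorem v₂d_eq : v₂d x = 4 * x / (chP x * chS x * (chS x + 2 * chP x)) := by
  have hs := two_lt_chS hx
  have hp := chP_pos hx
  have hne : chS x + 2 * chP x ≠ 0 := by linarith
  have hne' : chS x ≠ 0 := by linarith
  rw [v₂d, div_eq_div_iff (pow_ne_zero 2 hne) (by positivity)]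
  have e : (0 * (chS x + 2 * chP x) - 2 * (-(4 * x) / chS x + 2 * (-x / chP x))) *
      (chP x * chS x * (chS x + 2 * chP x)) =
      (8 * x * chP x + 4 * x * chS x) * (chS x + 2 * chP x) := by
    field_simp
    ring
  rw [e]
  ring

/-- **The cancellation on the face:** `g(v₂(x))·|v₂'(x)| = 8x·p(x)/(7 − 4x²)²`. -/
theorem chG_v₂_mul_abs (hx0 : 0 < x) :
    chG (v₂ x) * |v₂d x| = 8 * x * chP x / (7 - 4 * x ^ 2) ^ 2 := by
  have hs := two_lt_chS hx
  have hp := chP_pos hx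
  have hne : chS x + 2 * chP x ≠ 0 := by linarith
  have hne' : chS x ≠ 0 := by linarith
  have hpos : 0 < v₂d x := by rw [v₂d_eq hx]; positivity
  rw [abs_of_pos hpos, v₂d_eq hx, chG_v₂ hx, ← chS_sq (hx74_of hx).le]
  field_simp
  ring

end facts

/-- On the curve `x² = β(v)` (`0 < v < 1`): `s(√β(v)) = 2(1 + v²)/(1 − v²)` and
`p(√β(v)) = 2v/(1 − v²)`, whence `v₁(√β(v)) = v`. -/
theorem v₁_sqrt_chβ {v : ℝ} (hv0 : 0 < v) (hv1 : v < 1) (hβ : 0 < chβ v) : v₁ (√(chβ v)) = v := by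
  have hv2 : 0 < 1 - v ^ 2 := by nlinarith
  have hx2 : √(chβ v) ^ 2 = chβ v := Real.sq_sqrt hβ.le
  have hS : chS (√(chβ v)) = 2 * (1 + v ^ 2) / (1 - v ^ 2) := by
    rw [chS, hx2]
    have h : 7 - 4 * chβ v = (2 * (1 + v ^ 2) / (1 - v ^ 2)) ^ 2 := by
      rw [chβ]; field_simp; ring
    rw [h]
    exact Real.sqrt_sq (by positivity)
  have hP : chP (√(chβ v)) = 2 * v / (1 - v ^ 2) := by
    rw [chP, hx2]
    have h : 3 / 4 - chβ v = (2 * v / (1 - v ^ 2)) ^ 2 := by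
      rw [chβ]; field_simp; ring
    rw [h]
    exact Real.sqrt_sq (by positivity)
  rw [v₁, hS, hP]
  field_simp
  ring

/-- On the curve `x² = α(v)` (`0 < v < 1`): `s(√α(v)) = (1 + v²)/v`, `p(√α(v)) = (1 − v²)/(2v)`,
whence `v₂(√α(v)) = v`. -/
theorem v₂_sqrt_chα {v : ℝ} (hv0 : 0 < v) (hv1 : v < 1) (hα : 0 < chα v) : v₂ (√(chα v)) = v := by
  have hv2 : 0 < 1 - v ^ 2 := by nlinarith
  have hx2 : √(chα v) ^ 2 = chα v := Real.sq_sqrt hα.le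
  have hS : chS (√(chα v)) = (1 + v ^ 2) / v := by
    rw [chS, hx2]
    have h : 7 - 4 * chα v = ((1 + v ^ 2) / v) ^ 2 := by
      rw [chα]; field_simp; ring
    rw [h]
    exact Real.sqrt_sq (by positivity)
  have hP : chP (√(chα v)) = (1 - v ^ 2) / (2 * v) := by
    rw [chP, hx2]
    have h : 3 / 4 - chα v = ((1 - v ^ 2) / (2 * v)) ^ 2 := by
      rw [chα]; field_simp; ring
    rw [h]
    exact Real.sqrt_sq (by positivity)
  rw [v₂, hS, hP]
  field_simp
  ring

end Summit.KontsevichZagierPeriods.RootDecompWalshStrata.ConicDescent.BallCube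

end
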